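import Literature.Computability.ImplicitComplexity.STATokenCode
import Literature.Computability.Complexity.StackNumeric
import Mathlib.Tactic.Ring
import Mathlib.Tactic.Linarith
import HarnessLib

/-!
# Shifting, β-substitution and the leftmost-outermost step on token codes in polynomial time

Support file for the `PTIME` soundness half of `STACapturesP` (GMR08 Thm. 3.5), continuing
`STATokenCode.lean`: the remaining list programs of `STATokens.lean` as `CodeFP` maps.

* `codeFP_shiftToks` — `(D, ts) ↦ shiftToks D ts`; the pass keeps a stack of binder depths
  (binary numerals bounded by the number of tokens read) and writes each token once, a variable
  index growing by at most `D` (`shift_inv`: the state is quadratic in the input);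
* `codeFP_substToks` — `(arg, body) ↦ substToks body arg`; each variable of the body is replaced
  by at most a shifted copy of the argument (`subst_inv`: cubic);
* `codeFP_loStepToks` — **the leftmost-outermost β-step on codes is polynomial time**
  (composition of `codeFP_splitRedex`, `codeFP_spanTerm`, `codeFP_substToks`).

## References

* [GaboardiMarionRonchidellarocca2008] GMR08, Thm. 3.5.
* S. Arora, B. Barak, Computational Complexity: A Modern Approach, CUP 2009, §1.3 [AroraBarak2009].
-/

namespace Literature.Computability.ImplicitComplexity

namespace STA

open Literature.Computability.Complexity Literature.Computability.Complexity.CodeFP Polynomial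

/-! ### Numeral and code length facts -/

/-- `|natE (a + b)| ≤ |natE a| + |natE b| + 1`. [folklore] -/
theorem length_natE_add_le (a b : ℕ) : (natE (a + b)).length ≤ (natE a).length + (natE b).length + 1 := by
  show (Computability.encodeNat (a + b)).length ≤
    (Computability.encodeNat a).length + (Computability.encodeNat b).length + 1
  have := Literature.Computability.Complexity.length_encodeNat_add_le a b
  omega

/-- Code of a variable token. [folklore] -/
theorem length_tokE_V (k : ℕ) : (tokE (.V k)).length = 2 + (natE k).length := by
  simp [tokE, pairE_apply, length_boolPair, Tok.tag, Tok.idx]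

/-- Shifting a variable index by `D` lengthens its token's raw code by at most `2|natE D| + 2`.
[folklore] -/
theorem length_rawE_V_shift_le (k D : ℕ) :
    (rawE tokE [.V (k + D)]).length ≤ (rawE tokE [.V k]).length + (2 * (natE D).length + 2) := by
  rw [length_rawE_singleton, length_rawE_singleton, length_tokE_V, length_tokE_V]
  have := length_natE_add_le k D
  omega

/-- Lowering a variable index does not lengthen the raw code. [folklore] -/
theorem length_rawE_V_mono {k k' : ℕ} (h : k' ≤ k) : (rawE tokE [.V k']).length ≤ (rawE tokE [.V k]).length := by
  rw [length_rawE_singleton, length_rawE_singleton, length_tokE_V, length_tokE_V]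
  have : (natE k').length ≤ (natE k).length := Brick.length_encodeNat_mono h
  omega

/-- Raw code of a list of bounded numerals. [folklore] -/
theorem length_rawE_nat_le {l : List ℕ} {B : ℕ} (h : ∀ d ∈ l, d ≤ B) :
    (rawE natE l).length ≤ l.length * (2 * B + 2) := by
  rw [length_rawE]
  calc (l.map fun d => 2 * (natE d).length + 2).sum
      ≤ (l.map fun d => 2 * (natE d).length + 2).length • (2 * B + 2) :=
        List.sum_le_card_nsmul _ _ fun x hx => by
          obtain ⟨d, hd, rfl⟩ := List.mem_map.1 hx
          have := (length_natE_le d).trans (h d hd)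
          omega
    _ = l.length * (2 * B + 2) := by rw [List.length_map, smul_eq_mul]

/-- The head (default `0`) of a stack of bounded depths is bounded. [folklore] -/
theorem headD_le_of_forall {stk : List ℕ} {m : ℕ} (h : ∀ d ∈ stk, d ≤ m) : stk.headD 0 ≤ m := by
  cases stk with
  | nil => simp
  | cons d stk => exact h d (by simp)

/-- The tail of a stack of bounded depths is bounded. [folklore] -/
theorem forall_tail_le {stk : List ℕ} {m : ℕ} (h : ∀ d ∈ stk, d ≤ m) : ∀ d ∈ stk.tail, d ≤ m :=
  fun d hd => h d (List.mem_of_mem_tail hd)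

/-! ### Shifting -/

/-- Code of the pass state `(depth stack, output)`. [folklore] -/
def stkE : List ℕ × List Tok → List Bool := pairE (rawE natE) (rawE tokE)

/-- One shift step is computed on codes (context `D`). [folklore] -/
theorem codeFP_shiftStep :
    CodeFP (pairE natE (pairE tokE stkE)) stkE (fun q => shiftStep q.1 q.2.2 q.2.1) := by
  have hD : CodeFP (pairE natE (pairE tokE stkE)) natE (fun q => q.1) := fst _ _
  have ht : CodeFP (pairE natE (pairE tokE stkE)) tokE (fun q => q.2.1) := (snd _ _).fst'
  have hstk0 : CodeFP (pairE natE (pairE tokE stkE)) (rawE natE) (fun q => q.2.2.1) := (snd _ _).snd'.fst'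
  have hout : CodeFP (pairE natE (pairE tokE stkE)) (rawE tokE) (fun q => q.2.2.2) := (snd _ _).snd'.snd'
  have hd : CodeFP (pairE natE (pairE tokE stkE)) natE (fun q => q.2.2.1.headD 0) :=
    (rawHeadD natE (d := 0) (by simp)).comp hstk0
  have hstk : CodeFP (pairE natE (pairE tokE stkE)) (rawE natE) (fun q => q.2.2.1.tail) :=
    (rawTail natE).comp hstk0
  have hk : CodeFP (pairE natE (pairE tokE stkE)) natE (fun q => q.2.1.idx) := codeFP_idx.comp ht
  have hnew : CodeFP (pairE natE (pairE tokE stkE)) natE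
      (fun q => if decide (q.2.2.1.headD 0 ≤ q.2.1.idx) then q.2.1.idx + q.1 else q.2.1.idx) :=
    ite (natLe.comp (hd.pair hk)) (natAdd.comp (hk.pair hD)) hk
  have bV : CodeFP (pairE natE (pairE tokE stkE)) stkE (fun q =>
      (q.2.2.1.tail, q.2.2.2 ++ [Tok.V (if decide (q.2.2.1.headD 0 ≤ q.2.1.idx) then q.2.1.idx + q.1 else q.2.1.idx)])) :=
    hstk.pair ((rawAppend tokE).comp (hout.pair ((rawSingleton tokE).comp (codeFP_V.comp hnew))))
  have bL : CodeFP (pairE natE (pairE tokE stkE)) stkE (fun q =>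
      ((q.2.2.1.headD 0 + 1) :: q.2.2.1.tail, q.2.2.2 ++ [Tok.L])) :=
    ((rawCons natE).comp ((natAdd.comp (hd.pair (const _ 1))).pair hstk)).pair
      ((rawAppend tokE).comp (hout.pair (const _ [Tok.L])))
  have bAS : CodeFP (pairE natE (pairE tokE stkE)) stkE (fun q =>
      (q.2.2.1.headD 0 :: q.2.2.1.headD 0 :: q.2.2.1.tail, q.2.2.2 ++ [q.2.1])) :=
    ((rawCons natE).comp (hd.pair ((rawCons natE).comp (hd.pair hstk)))).pair
      ((rawAppend tokE).comp (hout.pair ((rawSingleton tokE).comp ht)))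
  refine (ite ((codeFP_tagEq 0).comp ht) bV (ite (codeFP_isL.comp ht) bL bAS)).congr fun q => ?_
  obtain ⟨D, t, stk, out⟩ := q
  cases t with
  | V k => simp [Tok.tag, Tok.idx, shiftStep]
  | L => simp [Tok.tag, shiftStep]
  | A => simp [Tok.tag, shiftStep]
  | S => simp [Tok.tag, shiftStep]

/-- **Invariant of the shift pass** on arbitrary token lists: the stack grows by at most two per
token, its entries by at most one per token, and the output by at most the code of the token read
plus `2|natE D| + 2`. [folklore] -/
theorem shift_inv (D : ℕ) (xs : List Tok) (stk : List ℕ) (out : List Tok) (m : ℕ)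
    (hm : ∀ d ∈ stk, d ≤ m) :
    (xs.foldl (shiftStep D) (stk, out)).1.length ≤ stk.length + 2 * xs.length ∧
    (∀ d ∈ (xs.foldl (shiftStep D) (stk, out)).1, d ≤ m + xs.length) ∧
    (rawE tokE (xs.foldl (shiftStep D) (stk, out)).2).length ≤
      (rawE tokE out).length + (rawE tokE xs).length + xs.length * (2 * (natE D).length + 2) := by
  induction xs generalizing stk out m with
  | nil => simp; exact hm
  | cons t xs ih =>
    rw [List.foldl_cons]
    have hd0 : stk.headD 0 ≤ m := headD_le_of_forall hm
    have htl : ∀ d ∈ stk.tail, d ≤ m := forall_tail_le hm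
    have htl_len : stk.tail.length ≤ stk.length := by cases stk <;> simp
    have hcons : (rawE tokE (t :: xs)).length = (rawE tokE [t]).length + (rawE tokE xs).length := by
      rw [show t :: xs = [t] ++ xs from rfl, length_rawE_append]
    cases t with
    | V k =>
      set k' := (if stk.headD 0 ≤ k then k + D else k) with hk'
      have hs : shiftStep D (stk, out) (.V k) = (stk.tail, out ++ [.V k']) := by simp [shiftStep, hk']
      rw [hs]
      obtain ⟨h1, h2, h3⟩ := ih stk.tail (out ++ [.V k']) m htl
      refine ⟨by simp only [List.length_cons]; omega, fun d hd => (h2 d hd).trans (by simp), ?_⟩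
      have hV : (rawE tokE [Tok.V k']).length ≤ (rawE tokE [Tok.V k]).length + (2 * (natE D).length + 2) := by
        rw [hk']
        split_ifs
        · exact length_rawE_V_shift_le k D
        · omega
      rw [length_rawE_append] at h3
      rw [hcons, List.length_cons]
      nlinarith [h3, hV]
    | L =>
      have hs : shiftStep D (stk, out) .L = ((stk.headD 0 + 1) :: stk.tail, out ++ [.L]) := by
        simp [shiftStep]
      rw [hs]
      obtain ⟨h1, h2, h3⟩ := ih ((stk.headD 0 + 1) :: stk.tail) (out ++ [.L]) (m + 1)
        (fun d hd => by
          simp only [List.mem_cons] at hd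
          rcases hd with rfl | hd
          · omega
          · exact (htl d hd).trans (by omega))
      refine ⟨?_, fun d hd => (h2 d hd).trans (by simp; omega), ?_⟩
      · simp only [List.length_cons] at h1 ⊢; omega
      · rw [length_rawE_append] at h3
        rw [hcons, List.length_cons]
        nlinarith [h3]
    | A =>
      have hs : shiftStep D (stk, out) .A = (stk.headD 0 :: stk.headD 0 :: stk.tail, out ++ [.A]) := by
        simp [shiftStep]
      rw [hs]
      obtain ⟨h1, h2, h3⟩ := ih (stk.headD 0 :: stk.headD 0 :: stk.tail) (out ++ [.A]) m
        (fun d hd => by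
          simp only [List.mem_cons] at hd
          rcases hd with rfl | rfl | hd
          · exact hd0
          · exact hd0
          · exact htl d hd)
      refine ⟨?_, fun d hd => (h2 d hd).trans (by simp), ?_⟩
      · simp only [List.length_cons] at h1 ⊢; omega
      · rw [length_rawE_append] at h3
        rw [hcons, List.length_cons]
        nlinarith [h3]
    | S =>
      have hs : shiftStep D (stk, out) .S = (stk.headD 0 :: stk.headD 0 :: stk.tail, out ++ [.S]) := by
        simp [shiftStep]
      rw [hs]
      obtain ⟨h1, h2, h3⟩ := ih (stk.headD 0 :: stk.headD 0 :: stk.tail) (out ++ [.S]) m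
        (fun d hd => by
          simp only [List.mem_cons] at hd
          rcases hd with rfl | rfl | hd
          · exact hd0
          · exact hd0
          · exact htl d hd)
      refine ⟨?_, fun d hd => (h2 d hd).trans (by simp), ?_⟩
      · simp only [List.length_cons] at h1 ⊢; omega
      · rw [length_rawE_append] at h3
        rw [hcons, List.length_cons]
        nlinarith [h3]

/-- **The output of the shift pass is at most linear in the input times `|natE D|`.**
[folklore] -/
theorem length_rawE_shiftToks_le (D : ℕ) (xs : List Tok) :
    (rawE tokE (shiftToks D xs)).length ≤ (rawE tokE xs).length + xs.length * (2 * (natE D).length + 2) := by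
  obtain ⟨-, -, h3⟩ := shift_inv D xs [0] [] 0 (by simp)
  simpa [shiftToks] using h3

/-- **The shift state stays quadratic in the input.** [folklore] -/
theorem length_shiftState_le (D : ℕ) (l₁ l₂ : List Tok) :
    (stkE (l₁.foldl (shiftStep D) ([0], []))).length ≤
      (12 * X ^ 2 + 16 * X + 8 : Polynomial ℕ).eval (pairE natE (rawE tokE) (D, l₁ ++ l₂)).length := by
  obtain ⟨h1, h2, h3⟩ := shift_inv D l₁ [0] [] 0 (by simp)
  set st := l₁.foldl (shiftStep D) ([0], [])
  set n := (pairE natE (rawE tokE) (D, l₁ ++ l₂)).length with hn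
  have hnD : (natE D).length ≤ n := by simp only [hn, pairE_apply, length_boolPair]; omega
  have hnl : (rawE tokE l₁).length ≤ n := by
    simp only [hn, pairE_apply, length_boolPair, length_rawE_append]; omega
  have hl := length_le_rawE_tok l₁
  have hstk : (rawE natE st.1).length ≤ (1 + 2 * l₁.length) * (2 * l₁.length + 2) := by
    refine (length_rawE_nat_le (B := l₁.length) fun d hd => by simpa using h2 d hd).trans ?_
    exact Nat.mul_le_mul_right _ (by simpa using h1)
  simp only [rawE_nil, List.length_nil, Nat.zero_add] at h3
  have heval : (12 * X ^ 2 + 16 * X + 8 : Polynomial ℕ).eval n = 12 * n ^ 2 + 16 * n + 8 := by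
    simp [eval_add, eval_mul, eval_pow]
  rw [stkE, pairE_apply, length_boolPair, heval]
  nlinarith [hstk, h3, hnD, hnl, hl]

/-- **Shifting on codes is polynomial time.** [folklore] -/
theorem codeFP_shiftToks : CodeFP (pairE natE (rawE tokE)) (rawE tokE) (fun p => shiftToks p.1 p.2) := by
  have hf := foldl (σ := ℕ) (eσ := natE) (eα := tokE) (eβ := stkE)
    (step := fun D t st => shiftStep D st t) (init := fun _ => ([0], []))
    codeFP_shiftStep (const natE ([0], [])) (12 * X ^ 2 + 16 * X + 8)
    (fun D l₁ l₂ => length_shiftState_le D l₁ l₂)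
  exact ((snd (rawE natE) (rawE tokE)).comp hf).congr fun p => rfl

/-! ### The β-substitution -/

/-- One substitution step is computed on codes (context: the argument code). [folklore] -/
theorem codeFP_substStep :
    CodeFP (pairE (rawE tokE) (pairE tokE stkE)) stkE (fun q => substStep q.1 q.2.2 q.2.1) := by
  have harg : CodeFP (pairE (rawE tokE) (pairE tokE stkE)) (rawE tokE) (fun q => q.1) := fst _ _
  have ht : CodeFP (pairE (rawE tokE) (pairE tokE stkE)) tokE (fun q => q.2.1) := (snd _ _).fst'
  have hstk0 : CodeFP (pairE (rawE tokE) (pairE tokE stkE)) (rawE natE) (fun q => q.2.2.1) := (snd _ _).snd'.fst'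
  have hout : CodeFP (pairE (rawE tokE) (pairE tokE stkE)) (rawE tokE) (fun q => q.2.2.2) := (snd _ _).snd'.snd'
  have hd : CodeFP (pairE (rawE tokE) (pairE tokE stkE)) natE (fun q => q.2.2.1.headD 0) :=
    (rawHeadD natE (d := 0) (by simp)).comp hstk0
  have hstk : CodeFP (pairE (rawE tokE) (pairE tokE stkE)) (rawE natE) (fun q => q.2.2.1.tail) :=
    (rawTail natE).comp hstk0
  have hk : CodeFP (pairE (rawE tokE) (pairE tokE stkE)) natE (fun q => q.2.1.idx) := codeFP_idx.comp ht
  -- the emitted tokens for a variable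
  have hemit : CodeFP (pairE (rawE tokE) (pairE tokE stkE)) (rawE tokE) (fun q =>
      if decide (q.2.1.idx < q.2.2.1.headD 0) then [Tok.V q.2.1.idx]
      else if decide (q.2.1.idx = q.2.2.1.headD 0) then shiftToks (q.2.2.1.headD 0) q.1
      else [Tok.V (q.2.1.idx - 1)]) :=
    ite (natLt.comp (hk.pair hd)) ((rawSingleton tokE).comp (codeFP_V.comp hk))
      (ite (natEq.comp (hk.pair hd)) (codeFP_shiftToks.comp (hd.pair harg))
        ((rawSingleton tokE).comp (codeFP_V.comp (natSub.comp (hk.pair (const _ 1))))))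
  have bV : CodeFP (pairE (rawE tokE) (pairE tokE stkE)) stkE (fun q =>
      (q.2.2.1.tail, q.2.2.2 ++ (if decide (q.2.1.idx < q.2.2.1.headD 0) then [Tok.V q.2.1.idx]
        else if decide (q.2.1.idx = q.2.2.1.headD 0) then shiftToks (q.2.2.1.headD 0) q.1
        else [Tok.V (q.2.1.idx - 1)]))) :=
    hstk.pair ((rawAppend tokE).comp (hout.pair hemit))
  have bL : CodeFP (pairE (rawE tokE) (pairE tokE stkE)) stkE (fun q =>
      ((q.2.2.1.headD 0 + 1) :: q.2.2.1.tail, q.2.2.2 ++ [Tok.L])) :=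
    ((rawCons natE).comp ((natAdd.comp (hd.pair (const _ 1))).pair hstk)).pair
      ((rawAppend tokE).comp (hout.pair (const _ [Tok.L])))
  have bAS : CodeFP (pairE (rawE tokE) (pairE tokE stkE)) stkE (fun q =>
      (q.2.2.1.headD 0 :: q.2.2.1.headD 0 :: q.2.2.1.tail, q.2.2.2 ++ [q.2.1])) :=
    ((rawCons natE).comp (hd.pair ((rawCons natE).comp (hd.pair hstk)))).pair
      ((rawAppend tokE).comp (hout.pair ((rawSingleton tokE).comp ht)))
  refine (ite ((codeFP_tagEq 0).comp ht) bV (ite (codeFP_isL.comp ht) bL bAS)).congr fun q => ?_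
  obtain ⟨arg, t, stk, out⟩ := q
  cases t with
  | V k => simp [Tok.tag, Tok.idx, substStep]
  | L => simp [Tok.tag, substStep]
  | A => simp [Tok.tag, substStep]
  | S => simp [Tok.tag, substStep]

/-- **Invariant of the substitution pass** on arbitrary token lists. [folklore] -/
theorem subst_inv (arg : List Tok) (xs : List Tok) (stk : List ℕ) (out : List Tok) (m : ℕ)
    (hm : ∀ d ∈ stk, d ≤ m) :
    (xs.foldl (substStep arg) (stk, out)).1.length ≤ stk.length + 2 * xs.length ∧
    (∀ d ∈ (xs.foldl (substStep arg) (stk, out)).1, d ≤ m + xs.length) ∧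
    (rawE tokE (xs.foldl (substStep arg) (stk, out)).2).length ≤
      (rawE tokE out).length + (rawE tokE xs).length +
        xs.length * ((rawE tokE arg).length + arg.length * (2 * (natE (m + xs.length)).length + 2)) := by
  induction xs generalizing stk out m with
  | nil => simp; exact hm
  | cons t xs ih =>
    rw [List.foldl_cons]
    have hd0 : stk.headD 0 ≤ m := headD_le_of_forall hm
    have htl : ∀ d ∈ stk.tail, d ≤ m := forall_tail_le hm
    have htl_len : stk.tail.length ≤ stk.length := by cases stk <;> simp
    have hcons : (rawE tokE (t :: xs)).length = (rawE tokE [t]).length + (rawE tokE xs).length := by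
      rw [show t :: xs = [t] ++ xs from rfl, length_rawE_append]
    -- the per-token allowance is monotone in the depth bound
    set Q : ℕ → ℕ := fun M => (rawE tokE arg).length + arg.length * (2 * (natE M).length + 2) with hQ
    have hQmono : ∀ {a b : ℕ}, a ≤ b → Q a ≤ Q b := fun {a b} h => by
      simp only [hQ]
      have : (natE a).length ≤ (natE b).length := Brick.length_encodeNat_mono h
      nlinarith
    cases t with
    | V k =>
      set e := (if k < stk.headD 0 then [Tok.V k]
        else if k = stk.headD 0 then shiftToks (stk.headD 0) arg else [Tok.V (k - 1)]) with he
      have hs : substStep arg (stk, out) (.V k) = (stk.tail, out ++ e) := by simp [substStep, he]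
      rw [hs]
      obtain ⟨h1, h2, h3⟩ := ih stk.tail (out ++ e) m htl
      refine ⟨by simp only [List.length_cons]; omega, fun d hd => (h2 d hd).trans (by simp), ?_⟩
      have hebound : (rawE tokE e).length ≤ (rawE tokE [Tok.V k]).length + Q m := by
        rw [he]
        split_ifs with c1 c2
        · simp [hQ]
        · have := length_rawE_shiftToks_le (stk.headD 0) arg
          have hmono : (natE (stk.headD 0)).length ≤ (natE m).length := Brick.length_encodeNat_mono hd0
          simp only [hQ]
          nlinarith
        · have := length_rawE_V_mono (k := k) (k' := k - 1) (Nat.sub_le _ _)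
          simp only [hQ]; omega
      have hQm : Q m ≤ Q (m + (xs.length + 1)) := hQmono (by omega)
      have hQx : Q (m + xs.length) ≤ Q (m + (xs.length + 1)) := hQmono (by omega)
      rw [length_rawE_append] at h3
      rw [hcons, List.length_cons]
      simp only [hQ] at hQm hQx hebound
      nlinarith [h3, hebound, hQm, hQx]
    | L =>
      have hs : substStep arg (stk, out) .L = ((stk.headD 0 + 1) :: stk.tail, out ++ [.L]) := by
        simp [substStep]
      rw [hs]
      obtain ⟨h1, h2, h3⟩ := ih ((stk.headD 0 + 1) :: stk.tail) (out ++ [.L]) (m + 1)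
        (fun d hd => by
          simp only [List.mem_cons] at hd
          rcases hd with rfl | hd
          · omega
          · exact (htl d hd).trans (by omega))
      refine ⟨?_, fun d hd => (h2 d hd).trans (by simp; omega), ?_⟩
      · simp only [List.length_cons] at h1 ⊢; omega
      · rw [length_rawE_append] at h3
        rw [hcons, List.length_cons, show m + (xs.length + 1) = m + 1 + xs.length by omega]
        nlinarith [h3, Nat.zero_le ((rawE tokE arg).length + arg.length * (2 * (natE (m + 1 + xs.length)).length + 2))]
    | A =>
      have hs : substStep arg (stk, out) .A = (stk.headD 0 :: stk.headD 0 :: stk.tail, out ++ [.A]) := by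
        simp [substStep]
      rw [hs]
      obtain ⟨h1, h2, h3⟩ := ih (stk.headD 0 :: stk.headD 0 :: stk.tail) (out ++ [.A]) m
        (fun d hd => by
          simp only [List.mem_cons] at hd
          rcases hd with rfl | rfl | hd
          · exact hd0
          · exact hd0
          · exact htl d hd)
      refine ⟨?_, fun d hd => (h2 d hd).trans (by simp), ?_⟩
      · simp only [List.length_cons] at h1 ⊢; omega
      · rw [length_rawE_append] at h3
        rw [hcons, List.length_cons]
        have hQx : Q (m + xs.length) ≤ Q (m + (xs.length + 1)) := hQmono (by omega)
        simp only [hQ] at hQx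
        nlinarith [h3, hQx]
    | S =>
      have hs : substStep arg (stk, out) .S = (stk.headD 0 :: stk.headD 0 :: stk.tail, out ++ [.S]) := by
        simp [substStep]
      rw [hs]
      obtain ⟨h1, h2, h3⟩ := ih (stk.headD 0 :: stk.headD 0 :: stk.tail) (out ++ [.S]) m
        (fun d hd => by
          simp only [List.mem_cons] at hd
          rcases hd with rfl | rfl | hd
          · exact hd0
          · exact hd0
          · exact htl d hd)
      refine ⟨?_, fun d hd => (h2 d hd).trans (by simp), ?_⟩
      · simp only [List.length_cons] at h1 ⊢; omega
      · rw [length_rawE_append] at h3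
        rw [hcons, List.length_cons]
        have hQx : Q (m + xs.length) ≤ Q (m + (xs.length + 1)) := hQmono (by omega)
        simp only [hQ] at hQx
        nlinarith [h3, hQx]

/-- **The substitution state stays cubic in the input.** [folklore] -/
theorem length_substState_le (arg l₁ l₂ : List Tok) :
    (stkE (l₁.foldl (substStep arg) ([0], []))).length ≤
      (4 * X ^ 3 + 12 * X ^ 2 + 14 * X + 8 : Polynomial ℕ).eval (pairE (rawE tokE) (rawE tokE) (arg, l₁ ++ l₂)).length := by
  obtain ⟨h1, h2, h3⟩ := subst_inv arg l₁ [0] [] 0 (by simp)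
  set st := l₁.foldl (substStep arg) ([0], [])
  set n := (pairE (rawE tokE) (rawE tokE) (arg, l₁ ++ l₂)).length with hn
  have hna : (rawE tokE arg).length ≤ n := by simp only [hn, pairE_apply, length_boolPair]; omega
  have hnl : (rawE tokE l₁).length ≤ n := by
    simp only [hn, pairE_apply, length_boolPair, length_rawE_append]; omega
  have hl := length_le_rawE_tok l₁
  have ha := length_le_rawE_tok arg
  have hstk : (rawE natE st.1).length ≤ (1 + 2 * l₁.length) * (2 * l₁.length + 2) := by
    refine (length_rawE_nat_le (B := l₁.length) fun d hd => by simpa using h2 d hd).trans ?_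
    exact Nat.mul_le_mul_right _ (by simpa using h1)
  have hdepth : (natE (0 + l₁.length)).length ≤ n := (length_natE_le _).trans (by omega)
  simp only [rawE_nil, List.length_nil, Nat.zero_add] at h3
  rw [Nat.zero_add] at hdepth
  have heval : (4 * X ^ 3 + 12 * X ^ 2 + 14 * X + 8 : Polynomial ℕ).eval n = 4 * n ^ 3 + 12 * n ^ 2 + 14 * n + 8 := by
    simp [eval_add, eval_mul, eval_pow]
  rw [stkE, pairE_apply, length_boolPair, heval]
  have hout : (rawE tokE st.2).length ≤ n + n * (n + n * (2 * n + 2)) := by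
    refine h3.trans ?_
    have e1 : l₁.length * ((rawE tokE arg).length + arg.length * (2 * (natE l₁.length).length + 2)) ≤
        n * (n + n * (2 * n + 2)) :=
      Nat.mul_le_mul (by omega) (Nat.add_le_add hna (Nat.mul_le_mul (by omega) (by omega)))
    omega
  nlinarith [hstk, hout, hnl, hl]

/-- **The β-substitution on codes is polynomial time** (`(arg, body) ↦ body[arg/x₀]`). [folklore] -/
theorem codeFP_substToks :
    CodeFP (pairE (rawE tokE) (rawE tokE)) (rawE tokE) (fun p => substToks p.2 p.1) := by
  have hf := foldl (σ := List Tok) (eσ := rawE tokE) (eα := tokE) (eβ := stkE)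
    (step := fun arg t st => substStep arg st t) (init := fun _ => ([0], []))
    codeFP_substStep (const (rawE tokE) ([0], [])) (4 * X ^ 3 + 12 * X ^ 2 + 14 * X + 8)
    (fun arg l₁ l₂ => length_substState_le arg l₁ l₂)
  exact ((snd (rawE natE) (rawE tokE)).comp hf).congr fun p => rfl

/-! ### The whole step -/

/-- **The leftmost-outermost β-step on token codes is computed by a polynomial-time string
function** (GMR08: "every β-reduction step can be carried out on a Turing machine in a number of
steps polynomial in the size of the term"). [cite: GaboardiMarionRonchidellarocca2008, Thm. 3.5] -/
theorem codeFP_loStepToks : CodeFP (rawE tokE) (rawE tokE) loStepToks := by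
  have hsp := codeFP_splitRedex
  have hfound : CodeFP (rawE tokE) bitE (fun ts => (splitRedex ts).1) := hsp.fst'
  have hbef : CodeFP (rawE tokE) (rawE tokE) (fun ts => (splitRedex ts).2.1) := hsp.snd'.fst'
  have hpost : CodeFP (rawE tokE) (rawE tokE) (fun ts => (splitRedex ts).2.2) := hsp.snd'.snd'
  have hb : CodeFP (rawE tokE) (pairE (rawE tokE) (rawE tokE)) (fun ts => spanTerm (splitRedex ts).2.2) :=
    codeFP_spanTerm.comp hpost
  have ha : CodeFP (rawE tokE) (pairE (rawE tokE) (rawE tokE))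
      (fun ts => spanTerm (spanTerm (splitRedex ts).2.2).2) := codeFP_spanTerm.comp hb.snd'
  have hsub : CodeFP (rawE tokE) (rawE tokE)
      (fun ts => substToks (spanTerm (splitRedex ts).2.2).1 (spanTerm (spanTerm (splitRedex ts).2.2).2).1) :=
    codeFP_substToks.comp (ha.fst'.pair hb.fst')
  have hres : CodeFP (rawE tokE) (rawE tokE) (fun ts =>
      (splitRedex ts).2.1 ++ substToks (spanTerm (splitRedex ts).2.2).1 (spanTerm (spanTerm (splitRedex ts).2.2).2).1 ++
        (spanTerm (spanTerm (splitRedex ts).2.2).2).2) :=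
    (rawAppend tokE).comp (((rawAppend tokE).comp (hbef.pair hsub)).pair ha.snd')
  refine (ite hfound hres (CodeFP.id (rawE tokE))).congr fun ts => ?_
  simp only [loStepToks]
  rfl

end STA

end Literature.Computability.ImplicitComplexity
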